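import Literature.NumberTheory.LFunctions.GeneralizedBernoulliNumbers
import Mathlib.FieldTheory.Finite.Basic
import HarnessLib

/-!
# `p`-integrality of `B_{k,χ}/k` in the weights `k ∈ {p - 1, p, p + 1}` (Billerey–Menares 2016)

Topic `Literature/NumberTheory/LFunctions`; namespace `Literature.NumberTheory.LFunctions`.
THEOREMS ONLY (no definition, no named fact).

`GeneralizedBernoulliNumbers` proves that the generalized Bernoulli number
`B_{k,χ} = N^{k-1} ∑_c χ(c) B_k(c/N)` of a Dirichlet character `χ` modulo `N`, `p ∤ N`, is
`p`-integral for `k < p - 1` (Billerey–Menares 2018, Lemma 3, the window `l > k + 1`).  The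
weights of Billerey–Menares 2016, Thm. 2.2 — `k = l` (`b = 0`), `k = l + 1` (`b = 1`) and
`k = b + 1 ≤ l - 1` — fall outside that window exactly for `k ∈ {p - 1, p, p + 1}`; this file
supplies the `p`-integrality of the constant term `-B_{k,χ}/2k` of the Eisenstein series
`E_k^{𝟙,χ}` in these three weights (all from von Staudt–Clausen and Fermat's little theorem, as in
Washington, *Cyclotomic Fields*, §5.3; they are the cases `n ≡ 0, 1, 2 (mod p - 1)` of the
`p`-integrality of `L_p(1 - n, χωⁿ) = -(1 - χ(p)p^{n-1}) B_{n,χ}/n`, op. cit. Thm. 5.11–Cor. 5.13):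

* `padicValuation_bernoulli_le_one_of_not_dvd` — `B_i` is `p`-integral when `(p - 1) ∤ i`
  (von Staudt–Clausen); `exists_one_add_prime_mul_bernoulli` — `1 + p B_{p-1} ∈ p ℤ_{(p)}`
  (idem: `B_{p-1} ≡ -1/p`), whence `v_p(B_{p-1}) ≥ -1` and `p B_{p-1} ∈ ℤ_{(p)}`.
* **`k = p + 1`** (`padicValuation_genBernoulliCoeff_prime_add_one_le_one`,
  `generalizedBernoulli_prime_add_one_mem_subring`, `p ≥ 5`): every weight
  `N^p B_{p+1}(c/N)` is `p`-integral — in `B_{p+1}(x) = ∑ binom(p+1,i) B_{p+1-i} xⁱ` the only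
  non-integral Bernoulli number is `B_{p-1}`, with coefficient `binom(p+1,2) = p(p+1)/2`.
* **`k = p`** (`padicValuation_genBernoulliCoeff_prime_le`, `exists_generalizedBernoulli_prime_eq_mul`,
  `p ≠ 2`): every weight `N^{p-1} B_p(c/N)` lies in `p ℤ_{(p)}`, hence `B_{p,χ} ∈ p · S` for any
  subring `S` containing the values of `χ` and the `p`-integral rationals — the terms
  `2 ≤ i ≤ p - 1` of `B_p(x)` carry `p ∣ binom(p,i)`, and the two remaining ones combine to
  `p B_{p-1} (c/N) + (c/N)^p = ((1 + pB_{p-1}) c N^{p-1} + (c^p - c N^{p-1}))/N^p` with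
  `c^p ≡ c N^{p-1} (mod p)` (Fermat) — i.e. `B_{p,χ}/p` is `p`-integral (Kummer:
  `B_{p,χ}/p ≡ B_{1,χ} (1 + pB_{p-1}) ≡ 0`).
* **`k = p - 1`, `χ ≠ 𝟙`** (`generalizedBernoulli_prime_sub_one_mem_subring`, `p ≠ 2`): the only
  non-integral term of `N^{p-2} B_{p-1}(c/N)` is the constant `N^{p-2} B_{p-1}`, killed by
  `∑_c χ(c) = 0`.
* **`k = p - 1`, `χ = 𝟙`** (the corner of B–M 2016 Thm. 2.2 where `λ ∤ B_{k,ε₀}/2k`):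
  `exists_bernoulli_div_mul_pow_sub_one_eq_mul` — `(B_{p-1}/(4(p-1))) (M^{p-1} - 1) ∈ p ℤ_{(p)}`
  as soon as `M^{p-1} ≡ 1 (mod p²)` (`v_p(B_{p-1}) = -1` against `v_p(M^{p-1} - 1) ≥ 2`).
* `neg_generalizedBernoulli_div_mem_subring` — the assembled statement: for `p ≥ 5`, `p ∤ N`,
  `3 ≤ k` and [`k < p - 1`, or `k = p - 1 ∧ χ ≠ 𝟙`, or `k = p`, or `k = p + 1`], the constant
  `-B_{k,χ}/4k` (`= ` half the constant term of `E_k^{𝟙,χ}`) lies in every subring of `ℂ`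
  containing the values of `χ` and the `p`-integral rationals.

## References

* N. Billerey, R. Menares, *On the modularity of reducible mod `l` Galois representations*, Math.
  Res. Lett. 23 (2016), §2, Thm. 2.2 (the weights `k ∈ {l, l+1, b+1}`) and its proof
  (`λ ∣ (B_{k,ε₀}/2k)(ε₀(p)p^k - 1)`). [BillereyMenares2016]
* L. C. Washington, *Introduction to Cyclotomic Fields*, 2nd ed., GTM 83 (1997), Thm. 5.10
  (von Staudt–Clausen), §5.3, Thm. 5.11–Cor. 5.15. [Washington1997]
* N. Billerey, R. Menares, *Strong modularity of reducible Galois representations*, Trans. AMS 370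
  (2018), Lemma 3. [BillereyMenares2018]
-/

open Finset WithZero

namespace Literature.NumberTheory.LFunctions

/-! ### von Staudt–Clausen consequences -/

section VonStaudt

variable {p : ℕ} [Fact p.Prime]

/-- **von Staudt–Clausen**: `B_i` is `p`-integral whenever `(p - 1) ∤ i` (for even `i > 0`,
`B_i + ∑_{(q-1) ∣ i} 1/q ∈ ℤ` and `p` is not among these primes `q`; `B_1 = -1/2` with `p ≠ 2`;
`B_i = 0` for odd `i > 1`). [cite: Washington1997, Thm. 5.10] -/
theorem padicValuation_bernoulli_le_one_of_not_dvd {i : ℕ} (hi : ¬ (p - 1) ∣ i) :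
    Rat.padicValuation p (bernoulli i) ≤ 1 := by
  classical
  have hp : p.Prime := Fact.out
  rcases Nat.even_or_odd i with hev | hod
  · obtain ⟨m, rfl⟩ : ∃ m, i = 2 * m := ⟨i / 2, by obtain ⟨a, rfl⟩ := hev; omega⟩
    rcases Nat.eq_zero_or_pos m with rfl | hm
    · exact absurd (dvd_zero _) hi
    · obtain ⟨T, hT⟩ := Bernoulli.vonStaudt_clausen m
      set P : Finset ℕ :=
        (Finset.range (2 * m + 2)).filter fun q ↦ q.Prime ∧ (q - 1) ∣ 2 * m with hPdef
      have hB : bernoulli (2 * m) = (T : ℚ) - ∑ q ∈ P, (1 : ℚ) / q := by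
        linear_combination hT.symm
      rw [hB]
      refine Valuation.map_sub_le _ ?_ (Valuation.map_sum_le _ fun q hq ↦ ?_)
      · rw [Rat.padicValuation_cast]
        exact Int.padicValuation_le_one p T
      · obtain ⟨-, hqprime, hqdvd⟩ := Finset.mem_filter.mp hq
        have hqp : ¬ p ∣ q := by
          intro h
          have := (Nat.prime_dvd_prime_iff_eq hp hqprime).mp h
          subst this
          exact hi hqdvd
        rw [one_div, map_inv₀, padicValuation_natCast_eq_one hqp, inv_one]
  · by_cases hi1 : i = 1
    · subst hi1
      have hp2 : ¬ p ∣ 2 := by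
        intro h
        have := (Nat.prime_dvd_prime_iff_eq hp Nat.prime_two).mp h
        subst this
        exact hi (by norm_num)
      rw [_root_.bernoulli_one, map_div₀, Valuation.map_neg, map_one,
        show (2 : ℚ) = ((2 : ℕ) : ℚ) by norm_num, padicValuation_natCast_eq_one hp2, div_one]
    · obtain ⟨r, hr⟩ := hod
      rw [bernoulli_eq_zero_of_odd ⟨r, hr⟩ (by omega), map_zero]
      exact bot_le

/-- **von Staudt–Clausen at `i = p - 1`**: `1 + p B_{p-1} = p y` with `y ∈ ℤ_{(p)}` (`p` odd),
i.e. `p B_{p-1} ≡ -1 (mod p ℤ_{(p)})`: in `B_{p-1} + ∑_{(q-1) ∣ (p-1)} 1/q ∈ ℤ` the prime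
`q = p` occurs. [cite: Washington1997, Thm. 5.10] -/
theorem exists_one_add_prime_mul_bernoulli (hp2 : p ≠ 2) :
    ∃ y : ℚ, Rat.padicValuation p y ≤ 1 ∧ 1 + (p : ℚ) * bernoulli (p - 1) = p * y := by
  classical
  have hp : p.Prime := Fact.out
  obtain ⟨m, hm⟩ : ∃ m, p - 1 = 2 * m := (hp.even_sub_one hp2).exists_two_nsmul _ |>.imp
    fun m h ↦ by simpa [two_mul] using h
  have hm0 : 0 < m := by have := hp.two_le; omega
  obtain ⟨T, hT⟩ := Bernoulli.vonStaudt_clausen m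
  set P : Finset ℕ :=
    (Finset.range (2 * m + 2)).filter fun q ↦ q.Prime ∧ (q - 1) ∣ 2 * m with hPdef
  have hpP : p ∈ P := by
    refine Finset.mem_filter.mpr ⟨Finset.mem_range.mpr (by omega), hp, ?_⟩
    rw [← hm]
  set S' : ℚ := ∑ q ∈ P.erase p, (1 : ℚ) / q with hS'def
  have hsum : ∑ q ∈ P, (1 : ℚ) / q = 1 / p + S' := by
    rw [hS'def, ← Finset.add_sum_erase P _ hpP]
  have hB : bernoulli (p - 1) = (T : ℚ) - S' - 1 / p := by
    rw [hm]
    have := hT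
    rw [hsum] at this
    linear_combination -this
  refine ⟨(T : ℚ) - S', ?_, ?_⟩
  · refine Valuation.map_sub_le _ ?_ (Valuation.map_sum_le _ fun q hq ↦ ?_)
    · rw [Rat.padicValuation_cast]
      exact Int.padicValuation_le_one p T
    · obtain ⟨hqp, hqP⟩ := Finset.mem_erase.mp hq
      obtain ⟨-, hqprime, -⟩ := Finset.mem_filter.mp hqP
      have hqp' : ¬ p ∣ q := fun h ↦ hqp ((Nat.prime_dvd_prime_iff_eq hp hqprime).mp h).symm
      rw [one_div, map_inv₀, padicValuation_natCast_eq_one hqp', inv_one]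
  · have hp0 : (p : ℚ) ≠ 0 := by exact_mod_cast hp.ne_zero
    rw [hB]
    field_simp
    ring

/-- `p B_{p-1}` is `p`-integral (`p` odd). [cite: Washington1997, Thm. 5.10] -/
theorem padicValuation_prime_mul_bernoulli_le_one (hp2 : p ≠ 2) :
    Rat.padicValuation p ((p : ℚ) * bernoulli (p - 1)) ≤ 1 := by
  obtain ⟨y, hy, h⟩ := exists_one_add_prime_mul_bernoulli hp2
  have h' : (p : ℚ) * bernoulli (p - 1) = p * y - 1 := by linear_combination h
  rw [h']
  refine Valuation.map_sub_le _ ?_ (by rw [map_one])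
  rw [map_mul, Rat.padicValuation_self]
  calc exp (-1 : ℤ) * Rat.padicValuation p y ≤ 1 * 1 :=
        mul_le_mul' (by rw [← exp_zero, exp_le_exp]; norm_num) hy
    _ = 1 := one_mul 1

/-- `v_p(B_{p-1}) ≥ -1`, multiplicatively `≤ exp 1` (`p` odd). [cite: Washington1997, Thm. 5.10] -/
theorem padicValuation_bernoulli_prime_sub_one_le (hp2 : p ≠ 2) :
    Rat.padicValuation p (bernoulli (p - 1)) ≤ exp 1 := by
  have hp : p.Prime := Fact.out
  have hp0 : (p : ℚ) ≠ 0 := by exact_mod_cast hp.ne_zero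
  have h := padicValuation_prime_mul_bernoulli_le_one hp2 (p := p)
  rw [map_mul, Rat.padicValuation_self] at h
  have hb : Rat.padicValuation p (bernoulli (p - 1)) =
      exp (1 : ℤ) * (exp (-1 : ℤ) * Rat.padicValuation p (bernoulli (p - 1))) := by
    rw [← mul_assoc, ← exp_add]; simp
  rw [hb]
  calc exp (1 : ℤ) * (exp (-1 : ℤ) * Rat.padicValuation p (bernoulli (p - 1))) ≤ exp 1 * 1 :=
        mul_le_mul' le_rfl h
    _ = exp 1 := mul_one _

end VonStaudt

/-! ### The weights `N^{k-1} B_k(c/N)` for `k ∈ {p + 1, p, p - 1}` -/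

section Weights

variable {p : ℕ} [Fact p.Prime]

/-- A binomial coefficient `binom(p, i)` with `0 < i < p` has valuation `≤ exp (-1)` (it is
divisible by `p`). [folklore] -/
theorem padicValuation_choose_le {i : ℕ} (hi0 : i ≠ 0) (hip : i < p) :
    Rat.padicValuation p ((p.choose i : ℕ) : ℚ) ≤ exp (-1) := by
  obtain ⟨m, hm⟩ := (Fact.out : p.Prime).dvd_choose_self hi0 hip
  rw [hm, Nat.cast_mul, map_mul, Rat.padicValuation_self]
  calc exp (-1 : ℤ) * Rat.padicValuation p (m : ℚ) ≤ exp (-1) * 1 :=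
        mul_le_mul' le_rfl (padicValuation_natCast_le_one m)
    _ = exp (-1) := mul_one _

/-- **`k = p + 1`**: the weight `N^p B_{p+1}(c/N)` is `p`-integral for `p ∤ N`, `p ≥ 5`.  In
`B_{p+1}(x) = ∑_i binom(p+1, i) B_{p+1-i} xⁱ` the Bernoulli numbers `B_j`, `j ≤ p + 1`,
`j ≠ p - 1`, are `p`-integral (`(p-1) ∤ j` unless `j ∈ {0, p-1}`), and `B_{p-1}` (`v_p = -1`)
comes with `binom(p+1, 2) = p (p+1)/2`. [cite: Washington1997, §5.3 (Thm. 5.11, Cor. 5.13)] -/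
theorem padicValuation_genBernoulliCoeff_prime_add_one_le_one (hp5 : 5 ≤ p) {N : ℕ}
    (hN : ¬ p ∣ N) (c : ℕ) : Rat.padicValuation p (genBernoulliCoeff (p + 1) N c) ≤ 1 := by
  have hp : p.Prime := Fact.out
  have hp2 : p ≠ 2 := by omega
  unfold genBernoulliCoeff
  rw [Polynomial.bernoulli_def, Polynomial.eval_finsetSum, Finset.mul_sum]
  refine Valuation.map_sum_le _ fun i hi ↦ ?_
  rw [Finset.mem_range] at hi
  rw [Polynomial.eval_monomial]
  simp only [map_mul, map_pow, map_div₀, map_zpow₀, padicValuation_natCast_eq_one hN, one_zpow,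
    one_mul, div_one]
  have key : Rat.padicValuation p (bernoulli (p + 1 - i)) *
      Rat.padicValuation p (((p + 1).choose i : ℕ) : ℚ) ≤ 1 := by
    by_cases h1 : p + 1 - i < p - 1
    · exact mul_le_one' (padicValuation_bernoulli_le_one h1) (padicValuation_natCast_le_one _)
    by_cases h2 : p + 1 - i = p - 1
    · -- `i = 2`, `binom(p+1, 2) = p · (p+1)/2`
      have hi2 : i = 2 := by omega
      subst hi2
      rcases hp.eq_two_or_odd with h | hodd
      · exact absurd h hp2
      set h := (p + 1) / 2 with hh
      have h2h : 2 * h = p + 1 := by omega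
      have hch : (p + 1).choose 2 = p * h := by
        rw [Nat.choose_two_right, Nat.add_sub_cancel, ← h2h, mul_comm (2 * h) p, ← mul_assoc,
          mul_comm p 2, mul_assoc, Nat.mul_div_cancel_left _ two_pos]
      rw [h2, hch, Nat.cast_mul, map_mul, Rat.padicValuation_self]
      calc Rat.padicValuation p (bernoulli (p - 1)) * (exp (-1 : ℤ) * Rat.padicValuation p (h : ℚ))
            ≤ exp 1 * (exp (-1 : ℤ) * 1) :=
            mul_le_mul' (padicValuation_bernoulli_prime_sub_one_le hp2)
              (mul_le_mul' le_rfl (padicValuation_natCast_le_one h))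
        _ = 1 := by rw [mul_one, ← exp_add]; simp
    · -- `p ≤ p + 1 - i ≤ p + 1`: `(p - 1) ∤ (p + 1 - i)`
      have hnd : ¬ (p - 1) ∣ (p + 1 - i) := by
        rintro ⟨t, ht⟩
        rcases t with _ | _ | t
        · omega
        · omega
        · have h0 : 0 ≤ (p - 1) * t := Nat.zero_le _
          have ht' : p + 1 - i = (p - 1) * t + 2 * (p - 1) := by rw [ht]; ring
          omega
      exact mul_le_one' (padicValuation_bernoulli_le_one_of_not_dvd hnd)
        (padicValuation_natCast_le_one _)
  exact mul_le_one' key (pow_le_one' (padicValuation_natCast_le_one c) _)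

/-- Fermat: `c^p ≡ c N^{p-1} (mod p)` for `p ∤ N`. [folklore] -/
theorem prime_dvd_pow_sub_mul_pow {N : ℕ} (hN : ¬ p ∣ N) (c : ℕ) :
    (p : ℤ) ∣ (c : ℤ) ^ p - c * (N : ℤ) ^ (p - 1) := by
  have hN' : ((N : ℤ) : ZMod p) ≠ 0 := by
    rw [Int.cast_natCast, Ne, ZMod.natCast_eq_zero_iff]
    exact hN
  rw [← ZMod.intCast_zmod_eq_zero_iff_dvd]
  push_cast
  rw [ZMod.pow_card, Int.cast_natCast] at *
  rw [ZMod.pow_card_sub_one_eq_one hN', mul_one, sub_self]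

/-- **`k = p`**: the weight `N^{p-1} B_p(c/N)` lies in `p ℤ_{(p)}` for `p ∤ N`, `p` odd.  The terms
`2 ≤ i ≤ p - 1` of `B_p(x) = ∑_i binom(p,i) B_{p-i} xⁱ` have `p ∣ binom(p, i)` and `B_{p-i}`
integral, `B_p = 0`, and the two remaining terms are
`p B_{p-1} x + x^p = p y x + (c^p - c N^{p-1})/N^p` (`x = c/N`, `1 + p B_{p-1} = p y`) with
`c^p ≡ c N^{p-1} (mod p)`. [cite: Washington1997, §5.3 (Thm. 5.11, Cor. 5.13)] -/
theorem padicValuation_genBernoulliCoeff_prime_le (hp2 : p ≠ 2) {N : ℕ} (hN : ¬ p ∣ N)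
    (c : ℕ) : Rat.padicValuation p (genBernoulliCoeff p N c) ≤ exp (-1) := by
  have hp : p.Prime := Fact.out
  have hp3 : 3 ≤ p := by have := hp.two_le; omega
  obtain ⟨n, hn⟩ : ∃ n, p = n + 2 := ⟨p - 2, by omega⟩
  have hN0 : N ≠ 0 := by rintro rfl; exact hN (dvd_zero p)
  have hNq : (N : ℚ) ≠ 0 := by exact_mod_cast hN0
  have hvN : Rat.padicValuation p (N : ℚ) = 1 := padicValuation_natCast_eq_one hN
  set x : ℚ := (c : ℚ) / N with hx
  have hvx : Rat.padicValuation p x ≤ 1 := by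
    rw [hx, map_div₀, hvN, div_one]; exact padicValuation_natCast_le_one c
  set f : ℕ → ℚ := fun i ↦ bernoulli (p - i) * ((p.choose i : ℕ) : ℚ) * x ^ i with hf
  have heval : (Polynomial.bernoulli p).eval x = ∑ i ∈ range (p + 1), f i := by
    rw [Polynomial.bernoulli_def, Polynomial.eval_finsetSum]
    refine Finset.sum_congr rfl fun i _ ↦ ?_
    rw [Polynomial.eval_monomial]
  -- peel off the terms `i = 0, 1, p`
  have hpeel : ∑ i ∈ range (p + 1), f i = (∑ i ∈ range n, f (i + 2)) + f 1 + f 0 + f p := by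
    rw [hn, Finset.sum_range_succ, Finset.sum_range_succ', Finset.sum_range_succ']
  have hf0 : f 0 = 0 := by
    simp only [hf, Nat.sub_zero, Nat.choose_zero_right, pow_zero, mul_one]
    rw [bernoulli_eq_zero_of_odd (hp.odd_of_ne_two hp2) (by omega), zero_mul]
  have hfp : f p = x ^ p := by
    simp only [hf, Nat.sub_self, bernoulli_zero, Nat.choose_self, Nat.cast_one, one_mul]
  have hf1 : f 1 = (p : ℚ) * bernoulli (p - 1) * x := by
    simp only [hf, Nat.choose_one_right, pow_one]; ring
  -- the terms `2 ≤ i ≤ p - 1`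
  have hR : Rat.padicValuation p (∑ i ∈ range n, f (i + 2)) ≤ exp (-1) := by
    refine Valuation.map_sum_le _ fun i hi ↦ ?_
    rw [Finset.mem_range] at hi
    simp only [hf, map_mul, map_pow]
    have hB : Rat.padicValuation p (bernoulli (p - (i + 2))) ≤ 1 :=
      padicValuation_bernoulli_le_one (by omega)
    have hC : Rat.padicValuation p ((p.choose (i + 2) : ℕ) : ℚ) ≤ exp (-1) :=
      padicValuation_choose_le (by omega) (by omega)
    calc Rat.padicValuation p (bernoulli (p - (i + 2))) *
          Rat.padicValuation p ((p.choose (i + 2) : ℕ) : ℚ) * Rat.padicValuation p x ^ (i + 2)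
          ≤ 1 * exp (-1) * 1 := mul_le_mul' (mul_le_mul' hB hC) (pow_le_one' hvx _)
      _ = exp (-1) := by rw [one_mul, mul_one]
  -- the two extreme terms
  obtain ⟨y, hy, hy'⟩ := exists_one_add_prime_mul_bernoulli hp2 (p := p)
  obtain ⟨z, hz⟩ := prime_dvd_pow_sub_mul_pow hN c (p := p)
  have hE : f 1 + f p = (p : ℚ) * (y * x + (z : ℚ) / (N : ℚ) ^ p) := by
    have hz' : ((c : ℚ)) ^ p - c * (N : ℚ) ^ (p - 1) = p * z := by exact_mod_cast hz
    have hNp : (N : ℚ) ^ p = (N : ℚ) ^ (p - 1) * N := by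
      rw [← pow_succ, Nat.sub_add_cancel hp.one_le]
    rw [hf1, hfp, hx, div_pow, mul_add]
    have : (p : ℚ) * bernoulli (p - 1) = p * y - 1 := by linear_combination hy'
    rw [this]
    field_simp
    rw [hNp]
    linear_combination (N : ℚ) * hz'
  have hE' : Rat.padicValuation p (f 1 + f p) ≤ exp (-1) := by
    rw [hE, map_mul, Rat.padicValuation_self]
    have h1 : Rat.padicValuation p (y * x) ≤ 1 := by
      rw [map_mul]; exact mul_le_one' hy hvx
    have h2 : Rat.padicValuation p ((z : ℚ) / (N : ℚ) ^ p) ≤ 1 := by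
      rw [map_div₀, map_pow, hvN, one_pow, div_one, Rat.padicValuation_cast]
      exact Int.padicValuation_le_one p z
    calc exp (-1 : ℤ) * Rat.padicValuation p (y * x + (z : ℚ) / (N : ℚ) ^ p) ≤ exp (-1) * 1 :=
          mul_le_mul' le_rfl (Valuation.map_add_le _ h1 h2)
      _ = exp (-1) := mul_one _
  -- assemble
  rw [genBernoulliCoeff_of_one_le hp.one_le, heval, hpeel, hf0, add_zero, map_mul, map_pow, hvN,
    one_pow, one_mul, add_assoc]
  exact Valuation.map_add_le _ hR hE'

/-- **`k = p - 1`**: `N^{p-2} B_{p-1}(c/N) = r + N^{p-2} B_{p-1}` with `r` `p`-integral (`p ∤ N`,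
`p` odd): all the terms `i ≥ 1` of `B_{p-1}(x) = ∑_i binom(p-1,i) B_{p-1-i} xⁱ` are
`p`-integral. [cite: Washington1997, §5.3 (Thm. 5.11, Cor. 5.13)] -/
theorem exists_genBernoulliCoeff_prime_sub_one_eq (hp2 : p ≠ 2) {N : ℕ} (hN : ¬ p ∣ N) (c : ℕ) :
    ∃ r : ℚ, Rat.padicValuation p r ≤ 1 ∧
      genBernoulliCoeff (p - 1) N c = r + (N : ℚ) ^ (p - 2) * bernoulli (p - 1) := by
  have hp : p.Prime := Fact.out
  have hp3 : 3 ≤ p := by have := hp.two_le; omega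
  obtain ⟨n, hn⟩ : ∃ n, p - 1 = n + 1 := ⟨p - 2, by omega⟩
  have hvN : Rat.padicValuation p (N : ℚ) = 1 := padicValuation_natCast_eq_one hN
  set x : ℚ := (c : ℚ) / N with hx
  have hvx : Rat.padicValuation p x ≤ 1 := by
    rw [hx, map_div₀, hvN, div_one]; exact padicValuation_natCast_le_one c
  set f : ℕ → ℚ := fun i ↦ bernoulli (p - 1 - i) * (((p - 1).choose i : ℕ) : ℚ) * x ^ i with hf
  have heval : (Polynomial.bernoulli (p - 1)).eval x = ∑ i ∈ range (p - 1 + 1), f i := by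
    rw [Polynomial.bernoulli_def, Polynomial.eval_finsetSum]
    refine Finset.sum_congr rfl fun i _ ↦ ?_
    rw [Polynomial.eval_monomial]
  have hpeel : ∑ i ∈ range (p - 1 + 1), f i = (∑ i ∈ range (n + 1), f (i + 1)) + f 0 := by
    rw [hn, Finset.sum_range_succ']
  have hf0 : f 0 = bernoulli (p - 1) := by
    simp only [hf, Nat.sub_zero, Nat.choose_zero_right, Nat.cast_one, pow_zero, mul_one]
  refine ⟨(N : ℚ) ^ (p - 2) * ∑ i ∈ range (n + 1), f (i + 1), ?_, ?_⟩
  · rw [map_mul, map_pow, hvN, one_pow, one_mul]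
    refine Valuation.map_sum_le _ fun i hi ↦ ?_
    rw [Finset.mem_range] at hi
    simp only [hf, map_mul, map_pow]
    exact mul_le_one' (mul_le_one' (padicValuation_bernoulli_le_one (by omega))
      (padicValuation_natCast_le_one _)) (pow_le_one' hvx _)
  · rw [genBernoulliCoeff_of_one_le (by omega : 1 ≤ p - 1), heval, hpeel, hf0,
      show p - 1 - 1 = p - 2 by omega]
    ring

/-- **The corner `k = p - 1`, `χ = 𝟙`**: if `M^{p-1} ≡ 1 (mod p²)` then
`(B_{p-1}/(4(p-1))) (M^{p-1} - 1) = p y` with `y` `p`-integral (`p` odd): `v_p(B_{p-1}) = -1`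
(von Staudt–Clausen) against `v_p(M^{p-1} - 1) ≥ 2`.  This is the extra hypothesis of
Billerey–Menares 2016, Thm. 2.2 in the case `(k, ε) = (l - 1, 𝟙)`, where
`λ ∣ (B_{k,ε₀}/2k)(ε₀(M)M^k - 1)` is not implied by `ε₀(M) M^k ≡ 1`.
[cite: BillereyMenares2016, §2, Thm. 2.2] -/
theorem exists_bernoulli_div_mul_pow_sub_one_eq_mul (hp2 : p ≠ 2) {M : ℕ}
    (hM : M ^ (p - 1) % p ^ 2 = 1) :
    ∃ y : ℚ, Rat.padicValuation p y ≤ 1 ∧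
      bernoulli (p - 1) / (4 * ((p : ℚ) - 1)) * ((M : ℚ) ^ (p - 1) - 1) = p * y := by
  have hp : p.Prime := Fact.out
  have hp3 : 3 ≤ p := by have := hp.two_le; omega
  have hp1 : 1 < p ^ 2 := by nlinarith
  have hM1 : 1 ≤ M ^ (p - 1) := by
    by_contra h
    rw [not_le, Nat.lt_one_iff] at h
    rw [h, Nat.zero_mod] at hM
    exact zero_ne_one hM
  have hmod : 1 ≡ M ^ (p - 1) [MOD p ^ 2] := by
    rw [Nat.ModEq, Nat.mod_eq_of_lt hp1, hM]
  obtain ⟨t, ht⟩ := (Nat.modEq_iff_dvd' hM1).mp hmod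
  obtain ⟨y, hy, hy'⟩ := exists_one_add_prime_mul_bernoulli hp2 (p := p)
  have hp0 : (p : ℚ) ≠ 0 := by exact_mod_cast hp.ne_zero
  have hp1' : (p : ℚ) - 1 ≠ 0 := by
    have : (1 : ℚ) < p := by exact_mod_cast hp.one_lt
    linarith
  have hcast : ((M : ℚ)) ^ (p - 1) - 1 = (p : ℚ) ^ 2 * t := by
    have := congrArg (Nat.cast (R := ℚ)) ht
    push_cast [Nat.cast_sub hM1] at this
    linear_combination this
  refine ⟨(p * y - 1) * t / (4 * ((p : ℚ) - 1)), ?_, ?_⟩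
  · rw [map_div₀, map_mul]
    have h4 : Rat.padicValuation p (4 * ((p : ℚ) - 1)) = 1 := by
      have hc : (4 * ((p : ℚ) - 1)) = ((4 * (p - 1) : ℕ) : ℚ) := by
        push_cast [Nat.cast_sub hp.one_le]; ring
      rw [hc]
      refine padicValuation_natCast_eq_one fun h ↦ ?_
      rcases (Nat.Prime.dvd_mul hp).1 h with h4 | h4
      · exact hp2 ((Nat.prime_dvd_prime_iff_eq hp Nat.prime_two).mp
          (hp.dvd_of_dvd_pow (show p ∣ 2 ^ 2 by simpa using h4)))
      · have := Nat.le_of_dvd (by omega) h4; omega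
    rw [h4, div_one]
    refine mul_le_one' (Valuation.map_sub_le _ ?_ (by rw [map_one])) ?_
    · rw [map_mul, Rat.padicValuation_self]
      calc exp (-1 : ℤ) * Rat.padicValuation p y ≤ 1 * 1 :=
            mul_le_mul' (by rw [← exp_zero, exp_le_exp]; norm_num) hy
        _ = 1 := one_mul 1
    · rw [← Int.cast_natCast, Rat.padicValuation_cast]; exact Int.padicValuation_le_one p t
  · have hB : bernoulli (p - 1) = (p * y - 1) / p := by
      field_simp
      linear_combination hy'
    rw [hB, hcast]
    field_simp

end Weights

/-! ### The generalized Bernoulli numbers `B_{p+1,χ}`, `B_{p,χ}`, `B_{p-1,χ}` -/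

section Character

variable {p : ℕ} [Fact p.Prime] {R : Type*} [CommRing R] [Algebra ℚ R] {N : ℕ} [NeZero N]

/-- **`B_{p+1,χ}` is `p`-integral** (`p ∤ N`, `p ≥ 5`): it lies in any subring containing the values
of `χ` and the `p`-integral rationals. [cite: Washington1997, §5.3 (Thm. 5.11, Cor. 5.13)] -/
theorem generalizedBernoulli_prime_add_one_mem_subring (hp5 : 5 ≤ p) (χ : DirichletCharacter R N)
    (S : Subring R) (hχ : ∀ j, χ j ∈ S)
    (hS : ∀ q : ℚ, Rat.padicValuation p q ≤ 1 → algebraMap ℚ R q ∈ S) (hN : ¬ p ∣ N) :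
    generalizedBernoulli (p + 1) χ ∈ S := by
  rw [generalizedBernoulli_eq_sum]
  exact Subring.sum_mem _ fun j _ ↦ Subring.mul_mem _ (hχ j)
    (hS _ (padicValuation_genBernoulliCoeff_prime_add_one_le_one hp5 hN _))

/-- **`B_{p,χ} ∈ p · S`** (`p ∤ N`, `p` odd) for any subring `S` containing the values of `χ` and the
`p`-integral rationals: `B_{p,χ}/p` is `p`-integral. [cite: Washington1997, §5.3 (Thm. 5.11, Cor. 5.13)] -/
theorem exists_generalizedBernoulli_prime_eq_mul (hp2 : p ≠ 2) (χ : DirichletCharacter R N)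
    (S : Subring R) (hχ : ∀ j, χ j ∈ S)
    (hS : ∀ q : ℚ, Rat.padicValuation p q ≤ 1 → algebraMap ℚ R q ∈ S) (hN : ¬ p ∣ N) :
    ∃ s ∈ S, generalizedBernoulli p χ = algebraMap ℚ R p * s := by
  have hp : p.Prime := Fact.out
  have hp0 : (p : ℚ) ≠ 0 := by exact_mod_cast hp.ne_zero
  refine ⟨∑ j : ZMod N, χ j * algebraMap ℚ R (genBernoulliCoeff p N j.val / p),
    Subring.sum_mem _ fun j _ ↦ Subring.mul_mem _ (hχ j) (hS _ ?_), ?_⟩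
  · rw [map_div₀, Rat.padicValuation_self, div_le_iff₀ (by simp), one_mul]
    exact padicValuation_genBernoulliCoeff_prime_le hp2 hN _
  · rw [generalizedBernoulli_eq_sum, Finset.mul_sum]
    refine Finset.sum_congr rfl fun j _ ↦ ?_
    rw [mul_left_comm, ← map_mul, mul_div_cancel₀ _ hp0]

/-- **`B_{p-1,χ}` is `p`-integral for `χ ≠ 𝟙`** (`p ∤ N`, `p` odd): the non-integral part
`N^{p-2} B_{p-1} ∑_c χ(c)` vanishes. [cite: Washington1997, §5.3 (Thm. 5.11, Cor. 5.13)] -/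
theorem generalizedBernoulli_prime_sub_one_mem_subring [IsDomain R] (hp2 : p ≠ 2)
    {χ : DirichletCharacter R N} (hχ1 : χ ≠ 1) (S : Subring R) (hχ : ∀ j, χ j ∈ S)
    (hS : ∀ q : ℚ, Rat.padicValuation p q ≤ 1 → algebraMap ℚ R q ∈ S) (hN : ¬ p ∣ N) :
    generalizedBernoulli (p - 1) χ ∈ S := by
  choose r hr hr' using fun c ↦ exists_genBernoulliCoeff_prime_sub_one_eq hp2 hN c (p := p)
  have hsum : generalizedBernoulli (p - 1) χ = ∑ j : ZMod N, χ j * algebraMap ℚ R (r j.val) := by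
    rw [generalizedBernoulli_eq_sum]
    have h : ∑ j : ZMod N, χ j * algebraMap ℚ R (genBernoulliCoeff (p - 1) N j.val) =
        ∑ j : ZMod N, χ j * algebraMap ℚ R (r j.val) +
          algebraMap ℚ R ((N : ℚ) ^ (p - 2) * bernoulli (p - 1)) * ∑ j : ZMod N, χ j := by
      rw [Finset.mul_sum, ← Finset.sum_add_distrib]
      refine Finset.sum_congr rfl fun j _ ↦ ?_
      rw [hr', map_add]
      ring
    rw [h, MulChar.sum_eq_zero_of_ne_one hχ1, mul_zero, add_zero]
  rw [hsum]
  exact Subring.sum_mem _ fun j _ ↦ Subring.mul_mem _ (hχ j) (hS _ (hr _))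

end Character

/-! ### The constant `-B_{k,χ}/4k` of `E_k^{𝟙,χ}` in the Billerey–Menares 2016 weights -/

section Complex

variable {p : ℕ} [Fact p.Prime] {N : ℕ} [NeZero N]

/-- Dividing an element of `S` by a natural number prime to `p` stays in `S`. [folklore] -/
theorem neg_div_natCast_mem {S : Subring ℂ}
    (hS : ∀ q : ℚ, Rat.padicValuation p q ≤ 1 → algebraMap ℚ ℂ q ∈ S) {B : ℂ} (hB : B ∈ S)
    {m : ℕ} (hm : ¬ p ∣ m) : -B / (m : ℂ) ∈ S := by
  have hq : Rat.padicValuation p (-(1 / m) : ℚ) ≤ 1 := by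
    rw [Valuation.map_neg, map_div₀, map_one, padicValuation_natCast_eq_one hm, div_one]
  have h := Subring.mul_mem S hB (hS _ hq)
  rw [map_neg, map_div₀, map_one, map_natCast] at h
  convert h using 1
  ring

/-- **The constant `-B_{k,χ}/4k` is `p`-integral in all the weights of Billerey–Menares 2016,
Thm. 2.2 off the corner `(k, χ) = (p - 1, 𝟙)`**: for `p ≥ 5`, `p ∤ N`, `k ≥ 3` and
[`k < p - 1` (the window of B–M 2018, Lemma 3), or `k = p - 1` with `χ ≠ 𝟙`, or `k = p`, or
`k = p + 1`], `-B_{k,χ}/4k` lies in every subring of `ℂ` containing the values of `χ` and the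
`p`-integral rationals. [cite: BillereyMenares2016, §2, Thm. 2.2] [cite: Washington1997, §5.3 (Thm. 5.11, Cor. 5.13)] -/
theorem neg_generalizedBernoulli_div_mem_subring (hp5 : 5 ≤ p) (χ : DirichletCharacter ℂ N)
    (S : Subring ℂ) (hχS : ∀ j, χ j ∈ S)
    (hS : ∀ q : ℚ, Rat.padicValuation p q ≤ 1 → algebraMap ℚ ℂ q ∈ S) (hN : ¬ p ∣ N)
    {k : ℕ} (hk3 : 3 ≤ k) (hk : k < p - 1 ∨ (k = p - 1 ∧ χ ≠ 1) ∨ k = p ∨ k = p + 1) :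
    -(generalizedBernoulli k χ) / (4 * k) ∈ S := by
  have hp : p.Prime := Fact.out
  have hp2 : p ≠ 2 := by omega
  -- `p ∤ 4 m` for `p ∤ m`
  have h4' : ¬ p ∣ 4 := fun h ↦ hp2 ((Nat.prime_dvd_prime_iff_eq hp Nat.prime_two).mp
    (hp.dvd_of_dvd_pow (show p ∣ 2 ^ 2 by simpa using h)))
  have h4 : ∀ {m : ℕ}, ¬ p ∣ m → ¬ p ∣ 4 * m := fun {m} hm h ↦ by
    rcases (Nat.Prime.dvd_mul hp).1 h with h4 | h4
    · exact h4' h4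
    · exact hm h4
  have hcast : ∀ m : ℕ, (4 * (m : ℂ)) = ((4 * m : ℕ) : ℂ) := fun m ↦ by push_cast; ring
  rcases hk with hk | ⟨rfl, hχ1⟩ | hk | rfl
  · rw [hcast]
    exact neg_div_natCast_mem hS (generalizedBernoulli_mem_subring χ S hχS hS hN hk)
      (h4 fun h ↦ by have := Nat.le_of_dvd (by omega) h; omega)
  · rw [hcast]
    exact neg_div_natCast_mem hS (generalizedBernoulli_prime_sub_one_mem_subring hp2 hχ1 S hχS hS hN)
      (h4 fun h ↦ by have := Nat.le_of_dvd (by omega) h; omega)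
  · obtain rfl : p = k := hk.symm
    obtain ⟨s, hs, hBs⟩ := exists_generalizedBernoulli_prime_eq_mul hp2 χ S hχS hS hN
    have hp0 : (p : ℂ) ≠ 0 := by exact_mod_cast hp.ne_zero
    have : -(generalizedBernoulli p χ) / (4 * p) = -s / ((4 : ℕ) : ℂ) := by
      rw [hBs, map_natCast]
      field_simp
      push_cast
      ring
    rw [this]
    exact neg_div_natCast_mem hS hs h4'
  · rw [show ((p + 1 : ℕ) : ℂ) = (p + 1 : ℕ) from rfl, hcast]
    exact neg_div_natCast_mem hS (generalizedBernoulli_prime_add_one_mem_subring hp5 χ S hχS hS hN)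
      (h4 fun h ↦ hp.one_lt.ne' (Nat.dvd_one.mp ((Nat.dvd_add_right (dvd_refl p)).mp h)))

end Complex

end Literature.NumberTheory.LFunctions
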